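/-
Copyright: the b2b-balaban cell (near-miss cell 7), T⁴-continuum CRUX team (coordinator ruling e34b3e0c item (2)),
row-NE7b OWNER lineage `t4-ne7b-p1` (gen 104). Released under the licence of the surrounding project.
-/
import Summits.QuantumFields.BalabanUV.T4Continuum.Spine.NE7b.BarePartitionFnNoFloor

/-!
# THE SINGLE-PLAQUETTE HAAR MASS OF `SU(N)` IS `< 1` — the window letter of `BarePartitionFnNoFloor` discharged for the
# headline's gauge group, and F-ne7bp1-g103-2 for `SU(N)` with a coupling floor only (row NE7b, part 3 of 3)

Cell `pub-balaban`, sub-cell `t4`, spine estimate NE7b (`T4WeightBudget.RelWeightBound`, the cell's OWN estimate — NOT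
PRINTED, NOT PROVED).  Crux-route work under `Spine/NE7b/`; no `T4Continuum/Support` leaf typed, no `Prop` of Bałaban's
minted, no `[cite:]` tag; zero `sorry`.  Imports the sibling `BarePartitionFnNoFloor`.

WHAT IS PROVED ([folklore]).
* §1 `linkMass_lt_one_of_continuous` — for any `GaugeGroup` carrying a topology with `Re tr` continuous and Haar data
  positive on non-empty open sets (no compatibility of the topology with the σ-algebra is needed for the inequality), ONE element `g` with `Re tr g < 1` gives `linkMass β < 1` for every `β > 0`
  (`1 − linkMass β = ∫ (1 − φ_β) dHaar > 0`: the integrand is non-negative and positive on the open set `{φ_β < 1} ∋ g`).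
* §2 `SU(N)`, `N ≥ 2` (the headline's group `Matrix.specialUnitaryGroup (Fin N) ℂ` with the tree's instances of
  `UnitaryModel` ∕ `QuantumLattice.GaugeGroups`: `reTr U = Re Tr U ∕ N`, Haar data = `haarMeasure ⊤`): `Re tr` is continuous,
  the Haar data is an open-positive measure, and the diagonal witness `diag(i, −i, 1, …, 1) ∈ SU(k+2)` has
  `Re tr = k∕(k+2) < 1`; hence **`linkMass_SU_lt_one : 2 ≤ N → 0 < β → linkMass β < 1`**.
* §3 **`no_uniform_supLetter_envelope_SU`** — F-ne7bp1-g103-2 for `SU(N)`, `N ≥ 2`, with the window letter of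
  `BarePartitionFnNoFloor.no_uniform_supLetter_envelope` replaced by a bare-coupling FLOOR `β_min ≤ (g₀ K)⁻²` (`β_min > 0`,
  `K ≥ K₀`) — which Bałaban's small-coupling regime supplies (`g₀ K ≤ γ` ⇒ `(g₀ K)⁻² ≥ γ⁻²`): the (α) END's letter family
  {`hBρ`, K-uniform `hBA`, `floor`, `sites`, (B)'s `Cor3With` on the interval} ⊢ `False` at the intended dressing.

HONEST REMARKS.  A finding about the ARCHITECTURE of the cell's own END records (term-wise sup-norm bookkeeping of an
un-normalised density), not about Bałaban's theorems; the END records stand as kernel objects; the owner's ruling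
W-ne7bp1-g103-1 re-cut the road at `…NE7b.PinnedExtraction.ExtractionLaws`.  Nothing of Bałaban's is asserted, valued or
discharged.  NE7b NOT PRINTED ∕ NOT PROVED; spine PROVED 0∕9; rung (B)+1 on a FINITE torus — NOT infinite volume, NOT the
mass gap, NOT Clay.
HONEST DEPENDENCY: continuum YM on T⁴ ⇐ BetaPertH ∧ nine spine estimates (0/9 proved); BetaPertH ⇐ (D1) ∧ (D4) ∧
CAP+tail; G-an2-4 gates asym, D1 and NE2/3/4.  This file changes none of it.
-/

set_option autoImplicit false

open MeasureTheory
open Literature.MathematicalPhysics.QuantumFieldTheory.Balaban1983to89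
open Literature.MathematicalPhysics.QuantumFieldTheory.Balaban1983to89.Missing
open Literature.MathematicalPhysics.QuantumFieldTheory.Balaban1983to89.T4Continuum
open Literature.MathematicalPhysics.QuantumFieldTheory.Balaban1983to89.T4StabilitySocket
open Summit.QuantumFields.BalabanUV.T4Continuum.NE7b.BarePartitionFnDecay
open Summit.QuantumFields.BalabanUV.T4Continuum.NE7b.BarePartitionFnNoFloor

namespace Summit.QuantumFields.BalabanUV.T4Continuum.NE7b.LinkMassSU

noncomputable section

/-! ## §1 A witness with `Re tr g < 1` and continuity make the single-plaquette mass `< 1` -/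

section Generic

variable {G : Type*} [GaugeGroup G] [MeasurableSpace G] [HaarData G] [RegularGaugeGroup G]
  [TopologicalSpace G]

omit [MeasurableSpace G] [HaarData G] [RegularGaugeGroup G] in
/-- `φ_β` is continuous once `Re tr` is. [folklore] -/
theorem continuous_plaqFactor (hcont : Continuous (reTr : G → ℝ)) (β : ℝ) :
    Continuous (plaqFactor (G := G) β) :=
  Real.continuous_exp.comp (continuous_const.mul (continuous_const.sub hcont))

omit [MeasurableSpace G] [HaarData G] [RegularGaugeGroup G] [TopologicalSpace G] in
/-- `φ_β(g) < 1` as soon as `Re tr g < 1` and `β > 0`. [folklore] -/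
theorem plaqFactor_lt_one {β : ℝ} (hβ : 0 < β) {g : G} (hg : reTr g < 1) : plaqFactor β g < 1 := by
  unfold plaqFactor
  rw [Real.exp_lt_one_iff]
  have h1 : 0 < 1 - reTr g := sub_pos.mpr hg
  nlinarith

/-- **ONE WITNESS `Re tr g < 1` ⇒ `linkMass β < 1` (`β > 0`)**, for Haar data positive on non-empty open sets and a
continuous `Re tr`: `1 − linkMass β = ∫ (1 − φ_β) dHaar > 0`. [folklore] -/
theorem linkMass_lt_one_of_continuous [(HaarData.haar : Measure G).IsOpenPosMeasure]
    (hcont : Continuous (reTr : G → ℝ)) {g : G} (hg : reTr g < 1) {β : ℝ} (hβ : 0 < β) :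
    linkMass (G := G) β < 1 := by
  haveI : IsProbabilityMeasure (HaarData.haar (G := G)) := HaarData.isProb
  have hint := integrable_plaqFactor (G := G) β
  have hnn : 0 ≤ fun V : G => 1 - plaqFactor β V := fun V => sub_nonneg.mpr (plaqFactor_le_one hβ.le V)
  have hpos : 0 < ∫ V, (1 - plaqFactor β V) ∂(HaarData.haar : Measure G) := by
    rw [integral_pos_iff_support_of_nonneg hnn ((integrable_const (1 : ℝ)).sub hint)]
    have hopen : IsOpen {V : G | plaqFactor β V < 1} :=
      isOpen_lt (continuous_plaqFactor hcont β) continuous_const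
    have hsub : {V : G | plaqFactor β V < 1} ⊆ Function.support fun V : G => 1 - plaqFactor β V := by
      intro V hV
      rw [Function.mem_support]
      exact ne_of_gt (sub_pos.mpr hV)
    exact lt_of_lt_of_le (hopen.measure_pos _ ⟨g, plaqFactor_lt_one hβ hg⟩) (measure_mono hsub)
  have hsplit : ∫ V, (1 - plaqFactor β V) ∂(HaarData.haar : Measure G) = 1 - linkMass (G := G) β := by
    have h1 : ∫ _ : G, (1 : ℝ) ∂(HaarData.haar : Measure G) = 1 := by simp
    rw [integral_sub (integrable_const (1 : ℝ)) hint, h1]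
    rfl
  linarith

end Generic

/-! ## §2 `SU(N)`, `N ≥ 2`: continuity, open-positivity of Haar, and the diagonal witness -/

section SU

open Literature.MathematicalPhysics.QuantumLattice (fundamentalRep continuous_fundamentalRep)

/-- On `SU(n)` the interface trace `reTr U = Re Tr U ∕ n` is continuous. [folklore] -/
theorem continuous_reTr_SU (n : Type) [Fintype n] [DecidableEq n] [Nonempty n] :
    Continuous (reTr : Matrix.specialUnitaryGroup n ℂ → ℝ) :=
  UnitaryModel.continuous_nReTr.comp (continuous_fundamentalRep n)

/-- The Haar data of `SU(n)` (= `haarMeasure ⊤`) is positive on non-empty open sets. [folklore] -/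
instance isOpenPosMeasure_haar_SU (n : Type) [Fintype n] [DecidableEq n] [Nonempty n] :
    (HaarData.haar : Measure (Matrix.specialUnitaryGroup n ℂ)).IsOpenPosMeasure := by
  haveI : LocallyCompactSpace (Matrix.specialUnitaryGroup n ℂ) :=
    Literature.RepresentationTheory.CompactGroups.CompactGroup.locallyCompactSpace_of_compactSpace_group
  show (Measure.haarMeasure (⊤ : TopologicalSpace.PositiveCompacts (Matrix.specialUnitaryGroup n ℂ))).IsOpenPosMeasure
  infer_instance

variable (k : ℕ)

/-- The witness's diagonal: `(i, −i, 1, …, 1)`. [folklore] -/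
def witnessVec : Fin (k + 2) → ℂ := fun i => if i = 0 then Complex.I else if i = 1 then -Complex.I else 1

/-- Every entry of the witness's diagonal has modulus one: `v_i · conj v_i = 1`. [folklore] -/
theorem witnessVec_mul_conj (i : Fin (k + 2)) : witnessVec k i * star (witnessVec k i) = 1 := by
  unfold witnessVec
  split_ifs <;> simp [Complex.conj_I, Complex.I_mul_I]

/-- The witness's determinant: `i · (−i) · 1 ⋯ 1 = 1`. [folklore] -/
theorem prod_witnessVec : ∏ i, witnessVec k i = 1 := by
  rw [Fin.prod_univ_succ, Fin.prod_univ_succ]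
  have h0 : witnessVec k 0 = Complex.I := by simp [witnessVec]
  have h1 : witnessVec k (Fin.succ 0) = -Complex.I := by
    simp [witnessVec, Fin.succ_zero_eq_one]
  have h2 : ∀ j : Fin k, witnessVec k j.succ.succ = 1 := by
    intro j
    have hj0 : j.succ.succ ≠ 0 := Fin.succ_ne_zero _
    have hj1 : j.succ.succ ≠ 1 := by
      rw [← Fin.succ_zero_eq_one]
      exact fun h => Fin.succ_ne_zero _ (Fin.succ_injective _ h)
    simp [witnessVec, hj0, hj1]
  simp only [h0, h1, h2, Finset.prod_const_one, mul_one]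
  rw [mul_neg, Complex.I_mul_I, neg_neg]

/-- **THE WITNESS `diag(i, −i, 1, …, 1) ∈ SU(k+2)`.** [folklore] -/
def witness : Matrix.specialUnitaryGroup (Fin (k + 2)) ℂ :=
  ⟨Matrix.diagonal (witnessVec k), by
    rw [Matrix.mem_specialUnitaryGroup_iff, Matrix.mem_unitaryGroup_iff, Matrix.det_diagonal, prod_witnessVec]
    refine ⟨?_, rfl⟩
    rw [Matrix.star_eq_conjTranspose, Matrix.diagonal_conjTranspose, Matrix.diagonal_mul_diagonal,
      ← Matrix.diagonal_one]
    congr 1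
    funext i
    exact witnessVec_mul_conj k i⟩

/-- `Re tr (witness) = k ∕ (k+2) < 1` (in fact we only use `< 1`: the real parts of the diagonal are `0, 0, 1, …, 1`).
[folklore] -/
theorem reTr_witness_lt_one : reTr (witness k) < 1 := by
  show UnitaryModel.nReTr (Matrix.diagonal (witnessVec k)) < 1
  unfold UnitaryModel.nReTr
  rw [Matrix.trace_diagonal, Complex.re_sum, Fintype.card_fin]
  have hcard : (0 : ℝ) < ((k + 2 : ℕ) : ℝ) := by positivity
  rw [div_lt_one hcard]
  have hle : ∀ i ∈ (Finset.univ : Finset (Fin (k + 2))), (witnessVec k i).re ≤ 1 := by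
    intro i _
    unfold witnessVec
    split_ifs <;> simp
  have hlt : ∃ i ∈ (Finset.univ : Finset (Fin (k + 2))), (witnessVec k i).re < 1 :=
    ⟨0, Finset.mem_univ _, by simp [witnessVec]⟩
  calc ∑ i, (witnessVec k i).re < ∑ _i : Fin (k + 2), (1 : ℝ) := Finset.sum_lt_sum hle hlt
    _ = ((k + 2 : ℕ) : ℝ) := by simp

/-- **`linkMass β < 1` on `SU(N)`, `N ≥ 2`, `β > 0`.** [folklore] -/
theorem linkMass_SU_lt_one {N : ℕ} [NeZero N] (hN : 2 ≤ N) {β : ℝ} (hβ : 0 < β) :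
    linkMass (G := Matrix.specialUnitaryGroup (Fin N) ℂ) β < 1 := by
  obtain ⟨k, rfl⟩ : ∃ k, N = k + 2 := ⟨N - 2, by omega⟩
  exact linkMass_lt_one_of_continuous (continuous_reTr_SU (Fin (k + 2))) (reTr_witness_lt_one k) hβ

end SU

/-! ## §3 F-ne7bp1-g103-2 for `SU(N)`: the END's letters + a bare-coupling floor are inconsistent -/

section T4

variable {F : T4Family} {N : ℕ} [NeZero N]

/-- **F-ne7bp1-g103-2 FOR THE HEADLINE's GROUP `SU(N)`, `N ≥ 2`, WITH ONLY A COUPLING FLOOR.**  For all cutoffs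
`K ≥ K₀` suppose: the dressed initial density `y ↦ e^{t·obs_K y}·D.dens K (g₀ K) 0 y` (`|obs_K| ≤ B_obs`) has a sup letter
`B K` (`hBρ`) with the K-UNIFORM envelope `log (B K) ≤ BA∞` (`hBA`); the (2.50) floor letters (`c₀ ≤ smallFieldMass`,
`numSites ≤ n₁`, `e₋(g_K) ≤ ē`); (B)'s `Cor3With` on the interval; and the bare couplings obey `β_min ≤ (g₀ K)⁻²` for one
`β_min > 0`.  Then `False` (`no_uniform_supLetter_envelope` with `θ := linkMass β_min < 1` by `linkMass_SU_lt_one` and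
`linkMass_window_of_floor`).  So for `SU(N)` the (α) road's END records admit no finite K-uniform `BA∞` at the intended
dressing in Bałaban's small-coupling regime. [folklore] -/
theorem no_uniform_supLetter_envelope_SU (hN : 2 ≤ N)
    (D : FiniteEpsData F (Matrix.specialUnitaryGroup (Fin N) ℂ)) (hsign : B16.SignConventions D.C)
    {γB : ℝ} {em ep : ℝ → ℝ} (hcor : B16.Cor3With D.C γB em ep) (g₀ : ℕ → ℝ) (K₀ : ℕ)
    (hI : ∀ K, K₀ ≤ K → (D.C ⟨K, F.m, g₀ K⟩).flow.InInterval γB K)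
    (obs : ∀ K, GaugeField (F.P K) 0 (Matrix.specialUnitaryGroup (Fin N) ℂ) → ℝ) {Bobs : ℝ}
    (hobs : ∀ K y, |obs K y| ≤ Bobs) (t : ℝ) (B : ℕ → ℝ) {BAi : ℝ}
    (hB : ∀ K, K₀ ≤ K → ∀ y, |Real.exp (t * obs K y) * D.dens K (g₀ K) 0 y| ≤ B K)
    (hBA : ∀ K, K₀ ≤ K → Real.log (B K) ≤ BAi)
    {c₀ n₁ ebar : ℝ} (hc₀ : 0 < c₀) (hfloor : ∀ K, K₀ ≤ K → c₀ ≤ smallFieldMass D K (g₀ K))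
    (hsites : ∀ K, K₀ ≤ K → ((D.C ⟨K, F.m, g₀ K⟩).numSites K : ℝ) ≤ n₁)
    (hem : ∀ K, K₀ ≤ K → em ((D.C ⟨K, F.m, g₀ K⟩).flow.g K) ≤ ebar) (hem0 : 0 ≤ ebar)
    {βmin : ℝ} (hβmin : 0 < βmin) (hβ : ∀ K, K₀ ≤ K → βmin ≤ (g₀ K)⁻¹ ^ 2) : False :=
  no_uniform_supLetter_envelope D hsign hcor g₀ K₀ hI obs hobs t B hB hBA hc₀ hfloor hsites hem hem0
    (linkMass_SU_lt_one hN hβmin) (linkMass_window_of_floor g₀ K₀ hβ)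

end T4

end

end Summit.QuantumFields.BalabanUV.T4Continuum.NE7b.LinkMassSU
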